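import Literature.AnabelianGeometry.EtaleTheta.Discharge.Sec2Cor28iiiInnerOfEmbedding
import HarnessLib

/-!
# [EtTh] Cor 2.8 (iii) at the §1 model, OUTER clauses 3–4 — Part A: the orbit bookkeeping that reduces
# «`γ_x` preserves `η̈^{Θ,l·ℤ}` / `η̲̈^{Θ,l·ℤ}` for `x ∈ Π^tp_Ċ` OUTSIDE `ι(Π^tp_X)`» to ONE class-level input (P-C5)

Mochizuki, *The Étale Theta Function …* [EtTh], Publ. RIMS 45 (2009), §2, Cor 2.8 (iii), PRIMS PDF p.42
(bib key `MochizukiEtTh2009`): "if … `γ` arises from an inner automorphism of … `Π^tp_{Ċ̲̲}`; `Π^tp_{Ċ̲}`, then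
`γ` preserves … `η̲̈^{Θ,l·ℤ}`; `η̈^{Θ,l·ℤ}` [i.e., without any constant multiple indeterminacy]" — proof p.42:
"immediate from the definitions".

PROOF-ONLY support file (no `def`, no `Prop` fact; seat abc-iut-w6-d049, block C / W6 tranche-2 row
EtTh:Cor2.8(i)/(iii) OUTER-γ companion, abc-iut-L2-lead 2026-08-26T08:33:17Z; SHAPES S1–S3 on STATUS 08:4xZ;
S1 = the OUTER cocycle-transport formula, split to abc-iut-w6-d051). abc-iut-L2-t2's
`Sec2Cor28iiiInnerOfEmbedding.lean` (p427195) proves clauses 1–2 of `ThetaOrbitData.Cor28_iii` for the orbit data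
`ThetaOrbitData.ofEmbedding ε hC hS` when `γ = γ_x` with `x = ι σ`, `σ ∈ Π^tp_X`: there the transport of a
class is `classOf (σ⁻¹ · c)` (`image_classOf_eq`) and an orbit collection over a conjugating set `S` with
`σ^{±1}·S ⊆ S` is mapped onto itself (`image_orbitColl_eq`).  For `x ∈ Π^tp_Ċ` OUTSIDE `ι(Π^tp_X)` there is
no such `σ`; the transport of a class is the image under an OUTER class map `A` (abc-iut-L6-t1's
`ContH1Aut.autMap` along the automorphism pair induced by `x`, S1), and the one NEW input is abc-iut-L2-d3's
census item P-C5: «`Π^tp_Ċ` moves the étale theta class `η̈^Θ` INSIDE its `Π^tp_{Ẋ̲}`-orbit»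
(`A η̈^Θ = σ₀ · η̈^Θ` for some `σ₀` in the dotted conjugating set).

THIS FILE. (A) The bookkeeping that does NOT depend on how the outer class map `A` is built: for ANY map on
functions `Φ` and ANY class map `A` with (a) `Φ '' classOf c = classOf (A c)` for every class `c` (S1's output),
(b) `A (σ·c) = a σ · A c` for the `Π^tp_X`-conjugation and a map `a` on conjugators, (c) P-C5 for the ONE class
`η̈^Θ` (`A η̈^Θ = σ₀ · η̈^Θ`), and (d) the conjugating set `S` carried onto itself by `s ↦ a s · σ₀`, the orbit
collection `{classOf (s·η̈^Θ) | s ∈ S}` is mapped onto itself by `Φ` (`image_orbitColl_eq_of_classMap`); likewise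
for root collections (`image_rootColl_eq_of_classMap`); abc-iut-L2-t2's inner `image_orbitColl_eq` is the
instance `A := σ⁻¹·(−)`, `a s := σ⁻¹ s σ`, `σ₀ := σ⁻¹` (checked as an `example`). (B) The OUTER clauses 3–4 of
`ThetaOrbitData.Cor28_iii` for `ofEmbedding ε hC hS` and ANY `x ∈ Π^tp_Ċ`, REDUCED to the two named inputs
bound in theorem position — (S1) the outer transport formula `hΦ`/`hΨ` with its action on conjugators `hA`,
`ha : ι (a s) = x⁻¹ · ι s · x` and the stability of `Π^tp_{X̲}` / `Π^tp_{X̲̲}` under `a`; (P-C5) `hη` with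
`σ₀ ∈ Π^tp_{Ẋ̲̲} ∩ Π^tp_X` —: `ofEmbedding_transport_outer_etaLZ_of`, `ofEmbedding_transport_outer_rootLZ_of`,
and `ofEmbedding_cor28_iii_outer_of` (the last two conjuncts of `Cor28_iii` verbatim). With abc-iut-L2-t2's
`ofEmbedding_cor28_iii_inner` (p427195) this exhausts Cor 2.8 (iii) at the §1 model modulo (S1) + (P-C5); the
sequel instantiates (S1) by abc-iut-w6-d051's file and leaves (P-C5) as the one residual input of the node.
HONEST FRAMING: [EtTh] is refereed; nothing beyond the displayed statements is claimed; no side is taken on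
[IUTchIII] Cor 3.12; P-C5 is NOT asserted here (it enters Part B in theorem position).
-/

noncomputable section

namespace Literature.AnabelianGeometry.EtaleTheta

open Literature.AnabelianGeometry.SemiGraphs ThetaCovers

universe u

namespace ThetaSetting.EtaleThetaData.DoubleUnderline.OrbitEmbedding

variable {p : ℕ} [Fact p.Prime] {D : ThetaSetting p} {E : D.EtaleThetaData} {l : ℕ}
  {C : E.DoubleUnderline l} {T : TemperedCoverData.{u} l} (ε : C.OrbitEmbedding T)

/-! ### Orbit collections under an outer class map -/

/-- **Transport of an orbit collection by an OUTER class map.** Let `Φ` act on functions `Π^tp_Ÿ → Δ_Θ` and `A`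
on classes with `Φ '' classOf c = classOf (A c)`; suppose `A (σ·c) = a σ · A c` for the `Π^tp_X`-conjugation,
`A η̈^Θ = σ₀ · η̈^Θ` (P-C5 for the one class `η̈^Θ`), and the conjugating set `S` satisfies `a s · σ₀ ∈ S` for
`s ∈ S` and every `s ∈ S` is of this form. Then `Φ` maps `{classOf (s·η̈^Θ) | s ∈ S}` onto itself.
[cite: MochizukiEtTh2009, Cor 2.8(iii) p.42] -/
theorem image_orbitColl_eq_of_classMap (hC : D.Compat)
    (Φ : (↥T.PiYddtp → ε.Coeff) → (↥T.PiYddtp → ε.Coeff))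
    (A : D.H1 D.GtpYdd → D.H1 D.GtpYdd)
    (hΦ : ∀ c : D.H1 D.GtpYdd, Φ '' ε.classOf c = ε.classOf (A c))
    (a : D.PiTemp → D.PiTemp)
    (hA : haveI := hC.GtpYdd_normal
      ∀ (σ : D.PiTemp) (c : D.H1 D.GtpYdd),
        A (ContH1.conj D.toTheta D.DeltaTheta σ c) = ContH1.conj D.toTheta D.DeltaTheta (a σ) (A c))
    (σ₀ : D.PiTemp)
    (hη : haveI := hC.GtpYdd_normal
      A E.etaDd = ContH1.conj D.toTheta D.DeltaTheta σ₀ E.etaDd)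
    {S : Set D.PiTemp} (h₁ : ∀ s ∈ S, a s * σ₀ ∈ S) (h₂ : ∀ s ∈ S, ∃ s' ∈ S, a s' * σ₀ = s) :
    (fun c => Φ '' c) '' ε.orbitColl hC S = ε.orbitColl hC S := by
  haveI := hC.GtpYdd_normal
  ext c
  constructor
  · rintro ⟨_, ⟨s, hs, rfl⟩, rfl⟩
    refine ⟨a s * σ₀, h₁ s hs, ?_⟩
    show Φ '' ε.classOf (ContH1.conj D.toTheta D.DeltaTheta s E.etaDd) = _
    rw [hΦ, hA, hη, ← ContH1.conj_mul_apply]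
  · rintro ⟨s, hs, rfl⟩
    obtain ⟨s', hs', hs'eq⟩ := h₂ s hs
    refine ⟨ε.classOf (ContH1.conj D.toTheta D.DeltaTheta s' E.etaDd), ⟨s', hs', rfl⟩, ?_⟩
    show Φ '' ε.classOf (ContH1.conj D.toTheta D.DeltaTheta s' E.etaDd) = _
    rw [hΦ, hA, hη, ← ContH1.conj_mul_apply, hs'eq]

/-- **Transport of a ROOT-orbit collection by an outer class map**: the same bookkeeping for the collections
`{rootClassOf (s·η̈^Θ) | s ∈ S}` of `l`-th root classes on `Π^tp_{Ÿ̲̲}`, given `Ψ '' rootClassOf c =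
rootClassOf (A c)`. [cite: MochizukiEtTh2009, Cor 2.8(iii) p.42] -/
theorem image_rootColl_eq_of_classMap (hC : D.Compat)
    (Ψ : (↥(T.PiYddtp ⊓ T.tp T.PiXuu) → ε.Coeff) → (↥(T.PiYddtp ⊓ T.tp T.PiXuu) → ε.Coeff))
    (A : D.H1 D.GtpYdd → D.H1 D.GtpYdd)
    (hΨ : ∀ c : D.H1 D.GtpYdd, Ψ '' ε.rootClassOf c = ε.rootClassOf (A c))
    (a : D.PiTemp → D.PiTemp)
    (hA : haveI := hC.GtpYdd_normal
      ∀ (σ : D.PiTemp) (c : D.H1 D.GtpYdd),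
        A (ContH1.conj D.toTheta D.DeltaTheta σ c) = ContH1.conj D.toTheta D.DeltaTheta (a σ) (A c))
    (σ₀ : D.PiTemp)
    (hη : haveI := hC.GtpYdd_normal
      A E.etaDd = ContH1.conj D.toTheta D.DeltaTheta σ₀ E.etaDd)
    {S : Set D.PiTemp} (h₁ : ∀ s ∈ S, a s * σ₀ ∈ S) (h₂ : ∀ s ∈ S, ∃ s' ∈ S, a s' * σ₀ = s) :
    (fun c => Ψ '' c) '' ε.rootColl hC S = ε.rootColl hC S := by
  haveI := hC.GtpYdd_normal
  ext c
  constructor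
  · rintro ⟨_, ⟨s, hs, rfl⟩, rfl⟩
    refine ⟨a s * σ₀, h₁ s hs, ?_⟩
    show Ψ '' ε.rootClassOf (ContH1.conj D.toTheta D.DeltaTheta s E.etaDd) = _
    rw [hΨ, hA, hη, ← ContH1.conj_mul_apply]
  · rintro ⟨s, hs, rfl⟩
    obtain ⟨s', hs', hs'eq⟩ := h₂ s hs
    refine ⟨ε.rootClassOf (ContH1.conj D.toTheta D.DeltaTheta s' E.etaDd), ⟨s', hs', rfl⟩, ?_⟩
    show Ψ '' ε.rootClassOf (ContH1.conj D.toTheta D.DeltaTheta s' E.etaDd) = _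
    rw [hΨ, hA, hη, ← ContH1.conj_mul_apply, hs'eq]

/-- Stability bookkeeping for a conjugating SUBMONOID-like set: if `S` is closed under multiplication and
inverses, `a` maps `S` into `S` and is surjective onto `S` from `S` (as for an automorphism normalising `S`),
and `σ₀ ∈ S`, then `s ↦ a s · σ₀` carries `S` onto itself (the two hypotheses `h₁`, `h₂` above).
[cite: MochizukiEtTh2009, Cor 2.8(iii) p.42] -/
theorem stable_of_mul_closed {S : Set D.PiTemp} (hmul : ∀ s ∈ S, ∀ t ∈ S, s * t ∈ S)
    (hinv : ∀ s ∈ S, s⁻¹ ∈ S) (a : D.PiTemp → D.PiTemp) (ha : ∀ s ∈ S, a s ∈ S)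
    (ha' : ∀ s ∈ S, ∃ s' ∈ S, a s' = s) {σ₀ : D.PiTemp} (hσ₀ : σ₀ ∈ S) :
    (∀ s ∈ S, a s * σ₀ ∈ S) ∧ (∀ s ∈ S, ∃ s' ∈ S, a s' * σ₀ = s) := by
  refine ⟨fun s hs => hmul _ (ha s hs) _ hσ₀, fun s hs => ?_⟩
  obtain ⟨s', hs', hs'eq⟩ := ha' (s * σ₀⁻¹) (hmul _ hs _ (hinv _ hσ₀))
  exact ⟨s', hs', by rw [hs'eq, inv_mul_cancel_right]⟩

/-- SANITY (the inner case is an instance): abc-iut-L2-t2's `image_orbitColl_eq` is recovered from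
`image_orbitColl_eq_of_classMap` with `Φ` = transport by `(γ_{ισ}, Γ_Θ)`, `A := σ⁻¹·(−)` (`image_classOf_eq`),
`a s := σ⁻¹ s σ`, `σ₀ := σ⁻¹`. [cite: MochizukiEtTh2009, Cor 2.8(iii) p.42] -/
example (hC : D.Compat) [ε.bot.Normal] (σ : D.PiTemp) (ΓΘ : ε.Coeff ≃* ε.Coeff)
    (hΘ : ∀ d, ΓΘ.symm (ε.coeffOf d) = ε.coeffOf (MulAut.conjNormal (D.toTheta σ⁻¹) d))
    (hmem : ∀ y : ↥T.PiYddtp, ε.ι σ * (y : T.Gtp) * (ε.ι σ)⁻¹ ∈ T.PiYddtp) {S : Set D.PiTemp}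
    (h₁ : ∀ s ∈ S, σ⁻¹ * s ∈ S) (h₂ : ∀ s ∈ S, σ * s ∈ S) :
    (fun c => (fun F : ↥T.PiYddtp → ε.Coeff => fun y : ↥T.PiYddtp => ΓΘ.symm (F ⟨_, hmem y⟩)) '' c) ''
        ε.orbitColl hC S = ε.orbitColl hC S := by
  haveI := hC.GtpYdd_normal
  refine ε.image_orbitColl_eq_of_classMap hC _ (ContH1.conj D.toTheta D.DeltaTheta σ⁻¹)
    (fun c => ε.image_classOf_eq σ ΓΘ hΘ hmem c) (fun s => σ⁻¹ * s * σ) (fun s c => ?_) σ⁻¹ rfl ?_ ?_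
  · rw [← ContH1.conj_mul_apply, ← ContH1.conj_mul_apply, mul_inv_cancel_right]
  · intro s hs
    rw [mul_inv_cancel_right]
    exact h₁ s hs
  · intro s hs
    exact ⟨σ * s, h₂ s hs, by rw [mul_inv_cancel_right, inv_mul_cancel_left]⟩

/-! ### Stability of the dotted conjugating sets under an outer conjugator -/

/-- `Π^tp_{Ẋ̲} ∩ Π^tp_X = dotXu` is closed under multiplication. [cite: MochizukiEtTh2009, Def 2.7 p.41] -/
theorem dotXu_mul_mem {s t : D.PiTemp} (hs : s ∈ ε.dotXu) (ht : t ∈ ε.dotXu) : s * t ∈ ε.dotXu :=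
  ⟨(D.GtpXu l).mul_mem hs.1 ht.1, by
    show ε.ι (s * t) ∈ T.PiCdot
    rw [map_mul]; exact T.PiCdot.mul_mem hs.2 ht.2⟩

/-- `dotXu` is closed under inverses. [cite: MochizukiEtTh2009, Def 2.7 p.41] -/
theorem dotXu_inv_mem {s : D.PiTemp} (hs : s ∈ ε.dotXu) : s⁻¹ ∈ ε.dotXu :=
  ⟨(D.GtpXu l).inv_mem hs.1, by
    show ε.ι s⁻¹ ∈ T.PiCdot
    rw [map_inv]; exact T.PiCdot.inv_mem hs.2⟩

/-- `Π^tp_{Ẋ̲̲} ∩ Π^tp_X = dotXuu` is closed under multiplication. [cite: MochizukiEtTh2009, Def 2.7 p.41] -/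
theorem dotXuu_mul_mem {s t : D.PiTemp} (hs : s ∈ ε.dotXuu) (ht : t ∈ ε.dotXuu) : s * t ∈ ε.dotXuu :=
  ⟨C.Huu.mul_mem hs.1 ht.1, by
    show ε.ι (s * t) ∈ T.PiCdot
    rw [map_mul]; exact T.PiCdot.mul_mem hs.2 ht.2⟩

/-- `dotXuu` is closed under inverses. [cite: MochizukiEtTh2009, Def 2.7 p.41] -/
theorem dotXuu_inv_mem {s : D.PiTemp} (hs : s ∈ ε.dotXuu) : s⁻¹ ∈ ε.dotXuu :=
  ⟨C.Huu.inv_mem hs.1, by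
    show ε.ι s⁻¹ ∈ T.PiCdot
    rw [map_inv]; exact T.PiCdot.inv_mem hs.2⟩

/-- A map `a` on `Π^tp_X` that is `x⁻¹`-CONJUGATION THROUGH `ι` (`ι (a s) = x⁻¹ · ι s · x`, the action on
conjugators of the outer class map of an `x ∈ Π^tp_Ċ`) and carries a subgroup-like set `G ⊆ Π^tp_X` onto itself
carries `G ∩ ι⁻¹Π^tp_Ċ` onto itself (`Π^tp_Ċ` is a subgroup containing `x`). [cite: MochizukiEtTh2009, Cor 2.8(iii) p.42] -/
theorem dot_stable_of_conjThrough {x : T.Gtp} (hx : x ∈ T.PiCdot) (a : D.PiTemp → D.PiTemp)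
    (ha : ∀ s, ε.ι (a s) = x⁻¹ * ε.ι s * x) {G : Set D.PiTemp} (haG : ∀ s ∈ G, a s ∈ G)
    (haG' : ∀ s ∈ G, ∃ s' ∈ G, a s' = s) :
    (∀ s ∈ {σ | σ ∈ G ∧ ε.ι σ ∈ T.PiCdot}, a s ∈ {σ | σ ∈ G ∧ ε.ι σ ∈ T.PiCdot}) ∧
    (∀ s ∈ {σ | σ ∈ G ∧ ε.ι σ ∈ T.PiCdot}, ∃ s' ∈ {σ | σ ∈ G ∧ ε.ι σ ∈ T.PiCdot}, a s' = s) := by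
  refine ⟨fun s hs => ⟨haG s hs.1, ?_⟩, fun s hs => ?_⟩
  · rw [ha]
    exact T.PiCdot.mul_mem (T.PiCdot.mul_mem (T.PiCdot.inv_mem hx) hs.2) hx
  · obtain ⟨s', hs'G, hs'eq⟩ := haG' s hs.1
    refine ⟨s', ⟨hs'G, ?_⟩, hs'eq⟩
    have h : ε.ι s' = x * ε.ι s * x⁻¹ := by
      have := ha s'
      rw [hs'eq] at this
      rw [this]; group
    rw [h]
    exact T.PiCdot.mul_mem (T.PiCdot.mul_mem hx hs.2) (T.PiCdot.inv_mem hx)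

/-! ### The outer clauses 3–4 of Cor 2.8 (iii) at `ofEmbedding`, REDUCED to (S1) + (P-C5) -/

/-- **Cor 2.8 (iii), clause 4 (OUTER case, reduced):** for `x ∈ Π^tp_Ċ` (any element of the dotted group —
in particular `x ∈ Π^tp_{Ċ̲} ∩ Π^tp_Ċ` OUTSIDE `ι(Π^tp_X)`) and `Γ_Θ` on the cyclotome, the transport
`(γ_x, Γ_Θ) · η̈^{Θ,l·ℤ}` IS `η̈^{Θ,l·ℤ}` PROVIDED: (S1) the transport of every transported class `classOf c` is
`classOf (A c)` for an outer class map `A` intertwining the `Π^tp_X`-conjugation through `a` = `x⁻¹`-conjugation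
through `ι` carrying `Π^tp_{X̲}` onto itself (abc-iut-w6-d051's outer transport formula, `ContH1Aut.autMap` along
the automorphism pair of `x`), and (P-C5) `A η̈^Θ = σ₀ · η̈^Θ` for some `σ₀ ∈ Π^tp_{Ẋ̲} ∩ Π^tp_X` — «`Π^tp_Ċ`
moves the étale theta class inside its `Π^tp_{Ẋ̲}`-orbit» (abc-iut-L2-d3 census P-C5; [EtTh] p.42 «immediate
from the definitions»). Both enter in THEOREM POSITION; nothing is asserted. [cite: MochizukiEtTh2009, Cor 2.8(iii) p.42] -/
theorem ofEmbedding_transport_outer_etaLZ_of (hC : D.Compat) (hS : D.Sec2Hyps) {x : T.Gtp}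
    (hx : x ∈ T.PiCdot) (ΓΘ : (ThetaOrbitData.ofEmbedding ε hC hS).DeltaTheta ≃* (ThetaOrbitData.ofEmbedding ε hC hS).DeltaTheta)
    (hY : T.PiYddtp.map (ThetaOrbitData.innerAutTop x).toMulEquiv.toMonoidHom = T.PiYddtp)
    -- (S1) the outer transport formula and its action on conjugators
    (A : D.H1 D.GtpYdd → D.H1 D.GtpYdd) (a : D.PiTemp → D.PiTemp)
    (hΦ : ∀ c : D.H1 D.GtpYdd,
      (fun F : ↥T.PiYddtp → ε.Coeff => fun y : ↥T.PiYddtp =>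
          ΓΘ.symm (F ⟨ThetaOrbitData.innerAutTop x y, hY.le (Subgroup.mem_map.mpr ⟨y, y.2, rfl⟩)⟩)) '' ε.classOf c =
        ε.classOf (A c))
    (hA : haveI := hC.GtpYdd_normal
      ∀ (σ : D.PiTemp) (c : D.H1 D.GtpYdd),
        A (ContH1.conj D.toTheta D.DeltaTheta σ c) = ContH1.conj D.toTheta D.DeltaTheta (a σ) (A c))
    (ha : ∀ s, ε.ι (a s) = x⁻¹ * ε.ι s * x)
    (haXu : ∀ s ∈ (D.GtpXu l : Set D.PiTemp), a s ∈ (D.GtpXu l : Set D.PiTemp))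
    (haXu' : ∀ s ∈ (D.GtpXu l : Set D.PiTemp), ∃ s' ∈ (D.GtpXu l : Set D.PiTemp), a s' = s)
    -- (P-C5) the one class-level input
    {σ₀ : D.PiTemp} (hσ₀ : σ₀ ∈ ε.dotXu)
    (hη : haveI := hC.GtpYdd_normal
      A E.etaDd = ContH1.conj D.toTheta D.DeltaTheta σ₀ E.etaDd) :
    (ThetaOrbitData.ofEmbedding ε hC hS).transport _ (ThetaOrbitData.innerAutTop x) hY ΓΘ (ThetaOrbitData.ofEmbedding ε hC hS).etaLZ =
      (ThetaOrbitData.ofEmbedding ε hC hS).etaLZ := by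
  have hst := ε.dot_stable_of_conjThrough hx a ha (G := (D.GtpXu l : Set D.PiTemp)) haXu haXu'
  obtain ⟨h₁, h₂⟩ := stable_of_mul_closed (S := ε.dotXu) (fun s hs t ht => ε.dotXu_mul_mem hs ht)
    (fun s hs => ε.dotXu_inv_mem hs) a hst.1 hst.2 hσ₀
  exact ε.image_orbitColl_eq_of_classMap hC _ A hΦ a hA σ₀ hη h₁ h₂

/-- **Cor 2.8 (iii), clause 3 (OUTER case, reduced):** the same for the ROOT collection `η̲̈^{Θ,l·ℤ}` on
`Π^tp_{Ÿ̲̲}`, for `x ∈ Π^tp_Ċ` with `a` carrying `Π^tp_{X̲̲} = C.Huu` onto itself, given (S1) on root classes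
and (P-C5) with `σ₀ ∈ Π^tp_{Ẋ̲̲} ∩ Π^tp_X`. [cite: MochizukiEtTh2009, Cor 2.8(iii) p.42] -/
theorem ofEmbedding_transport_outer_rootLZ_of (hC : D.Compat) (hS : D.Sec2Hyps) {x : T.Gtp}
    (hx : x ∈ T.PiCdot) (ΓΘ : (ThetaOrbitData.ofEmbedding ε hC hS).DeltaTheta ≃* (ThetaOrbitData.ofEmbedding ε hC hS).DeltaTheta)
    (hYuu : (T.PiYddtp ⊓ T.tp T.PiXuu).map (ThetaOrbitData.innerAutTop x).toMulEquiv.toMonoidHom =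
      T.PiYddtp ⊓ T.tp T.PiXuu)
    -- (S1) the outer transport formula on root classes and its action on conjugators
    (A : D.H1 D.GtpYdd → D.H1 D.GtpYdd) (a : D.PiTemp → D.PiTemp)
    (hΨ : ∀ c : D.H1 D.GtpYdd,
      (fun ξ : ↥(T.PiYddtp ⊓ T.tp T.PiXuu) → ε.Coeff => fun g : ↥(T.PiYddtp ⊓ T.tp T.PiXuu) =>
          ΓΘ.symm (ξ ⟨ThetaOrbitData.innerAutTop x g, hYuu.le (Subgroup.mem_map.mpr ⟨g, g.2, rfl⟩)⟩)) '' ε.rootClassOf c =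
        ε.rootClassOf (A c))
    (hA : haveI := hC.GtpYdd_normal
      ∀ (σ : D.PiTemp) (c : D.H1 D.GtpYdd),
        A (ContH1.conj D.toTheta D.DeltaTheta σ c) = ContH1.conj D.toTheta D.DeltaTheta (a σ) (A c))
    (ha : ∀ s, ε.ι (a s) = x⁻¹ * ε.ι s * x)
    (haXuu : ∀ s ∈ (C.Huu : Set D.PiTemp), a s ∈ (C.Huu : Set D.PiTemp))
    (haXuu' : ∀ s ∈ (C.Huu : Set D.PiTemp), ∃ s' ∈ (C.Huu : Set D.PiTemp), a s' = s)
    -- (P-C5) the one class-level input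
    {σ₀ : D.PiTemp} (hσ₀ : σ₀ ∈ ε.dotXuu)
    (hη : haveI := hC.GtpYdd_normal
      A E.etaDd = ContH1.conj D.toTheta D.DeltaTheta σ₀ E.etaDd) :
    (ThetaOrbitData.ofEmbedding ε hC hS).transport _ (ThetaOrbitData.innerAutTop x) hYuu ΓΘ (ThetaOrbitData.ofEmbedding ε hC hS).rootLZ =
      (ThetaOrbitData.ofEmbedding ε hC hS).rootLZ := by
  have hst := ε.dot_stable_of_conjThrough hx a ha (G := (C.Huu : Set D.PiTemp)) haXuu haXuu'
  obtain ⟨h₁, h₂⟩ := stable_of_mul_closed (S := ε.dotXuu) (fun s hs t ht => ε.dotXuu_mul_mem hs ht)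
    (fun s hs => ε.dotXuu_inv_mem hs) a hst.1 hst.2 hσ₀
  exact ε.image_rootColl_eq_of_classMap hC _ A hΨ a hA σ₀ hη h₁ h₂

/-- **Cor 2.8 (iii), clauses 3 ∧ 4 in the shape of the last two conjuncts of `ThetaOrbitData.Cor28_iii`** for
`O = ThetaOrbitData.ofEmbedding ε hC hS` and ANY `x ∈ Π^tp_Ċ` (the outer case included), REDUCED to (S1) + (P-C5) as above
(one class map `A` serving both the class and the root-class transport). With abc-iut-L2-t2's
`ofEmbedding_cor28_iii_inner` (clauses 1–2, p427195) this exhausts `Cor28_iii` at the §1 model modulo the two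
named inputs. [cite: MochizukiEtTh2009, Cor 2.8(iii) p.42] -/
theorem ofEmbedding_cor28_iii_outer_of (hC : D.Compat) (hS : D.Sec2Hyps) {x : T.Gtp} (hx : x ∈ T.PiCdot)
    (ΓΘ : (ThetaOrbitData.ofEmbedding ε hC hS).DeltaTheta ≃* (ThetaOrbitData.ofEmbedding ε hC hS).DeltaTheta)
    (hY : T.PiYddtp.map (ThetaOrbitData.innerAutTop x).toMulEquiv.toMonoidHom = T.PiYddtp)
    (hYuu : (T.PiYddtp ⊓ T.tp T.PiXuu).map (ThetaOrbitData.innerAutTop x).toMulEquiv.toMonoidHom =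
      T.PiYddtp ⊓ T.tp T.PiXuu)
    (A : D.H1 D.GtpYdd → D.H1 D.GtpYdd) (a : D.PiTemp → D.PiTemp)
    (hΦ : ∀ c : D.H1 D.GtpYdd,
      (fun F : ↥T.PiYddtp → ε.Coeff => fun y : ↥T.PiYddtp =>
          ΓΘ.symm (F ⟨ThetaOrbitData.innerAutTop x y, hY.le (Subgroup.mem_map.mpr ⟨y, y.2, rfl⟩)⟩)) '' ε.classOf c =
        ε.classOf (A c))
    (hΨ : ∀ c : D.H1 D.GtpYdd,
      (fun ξ : ↥(T.PiYddtp ⊓ T.tp T.PiXuu) → ε.Coeff => fun g : ↥(T.PiYddtp ⊓ T.tp T.PiXuu) =>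
          ΓΘ.symm (ξ ⟨ThetaOrbitData.innerAutTop x g, hYuu.le (Subgroup.mem_map.mpr ⟨g, g.2, rfl⟩)⟩)) '' ε.rootClassOf c =
        ε.rootClassOf (A c))
    (hA : haveI := hC.GtpYdd_normal
      ∀ (σ : D.PiTemp) (c : D.H1 D.GtpYdd),
        A (ContH1.conj D.toTheta D.DeltaTheta σ c) = ContH1.conj D.toTheta D.DeltaTheta (a σ) (A c))
    (ha : ∀ s, ε.ι (a s) = x⁻¹ * ε.ι s * x)
    (haXu : ∀ s ∈ (D.GtpXu l : Set D.PiTemp), a s ∈ (D.GtpXu l : Set D.PiTemp))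
    (haXu' : ∀ s ∈ (D.GtpXu l : Set D.PiTemp), ∃ s' ∈ (D.GtpXu l : Set D.PiTemp), a s' = s)
    (haXuu : ∀ s ∈ (C.Huu : Set D.PiTemp), a s ∈ (C.Huu : Set D.PiTemp))
    (haXuu' : ∀ s ∈ (C.Huu : Set D.PiTemp), ∃ s' ∈ (C.Huu : Set D.PiTemp), a s' = s)
    {σ₀ : D.PiTemp} (hσ₀ : σ₀ ∈ ε.dotXuu)
    (hη : haveI := hC.GtpYdd_normal
      A E.etaDd = ContH1.conj D.toTheta D.DeltaTheta σ₀ E.etaDd) :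
    (x ∈ T.tp T.PiCuu ⊓ T.PiCdot →
      (ThetaOrbitData.ofEmbedding ε hC hS).transport _ _ hYuu ΓΘ (ThetaOrbitData.ofEmbedding ε hC hS).rootLZ =
        (ThetaOrbitData.ofEmbedding ε hC hS).rootLZ) ∧
    (x ∈ T.tp T.PiCu ⊓ T.PiCdot →
      (ThetaOrbitData.ofEmbedding ε hC hS).transport _ _ hY ΓΘ (ThetaOrbitData.ofEmbedding ε hC hS).etaLZ =
        (ThetaOrbitData.ofEmbedding ε hC hS).etaLZ) :=
  ⟨fun _ => ε.ofEmbedding_transport_outer_rootLZ_of hC hS hx ΓΘ hYuu A a hΨ hA ha haXuu haXuu' hσ₀ hη,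
    fun _ => ε.ofEmbedding_transport_outer_etaLZ_of hC hS hx ΓΘ hY A a hΦ hA ha haXu haXu'
      ⟨C.Huu_le_GtpXu hσ₀.1, hσ₀.2⟩ hη⟩

end ThetaSetting.EtaleThetaData.DoubleUnderline.OrbitEmbedding

end Literature.AnabelianGeometry.EtaleTheta

end
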